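import Literature.MathematicalPhysics.QuantumFieldTheory.Balaban1983to89.B2Eq265PrintedSize

/-!
# `Balaban1983to89.B2Eq265PrintedThresholds` — [Balaban1982Higgs2] Lemma 2.4 (2.65) p.572, value clause «under the restrictions (2.55)», on
# the (Higgs)₂,₃ carrier of record: F18's grouped bound UNDER THE PRINTED THRESHOLDS OF (2.55) p.570 — «|(∂A)(b)| ≦ c₁p(L^{k−1}ε),
# |A(x)| ≦ (c₁/(μ₀L^{k−1}ε))p(L^{k−1}ε), |(D_{Ā^{(k)}}φ)(b)| ≦ c₁p(L^{k−1}ε), |φ(x)| ≦ (c₁/λ(L^{k−1}ε)^{1/4})p(L^{k−1}ε)» — taken at the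
# (2.55) letter `L^{k−1}ε ⇐ s/L`, `s ⇐ Lᵏε` the free physical scale of F18a, WITH THE POLYNOMIAL SIZE OF THE (2.55)₄ THRESHOLD DISCHARGED:
# `c₁p(s/L)/λ(s/L)^{1/4} ≤ (c₁λ^{−1/4}b₀L^{(4−d)/4+p})·s^{−((4−d)/4+p)}` (own `B2Eq2108ErrorBound.printedThreshold_thrPhi_le`, (2.2) `p(ε) =
# b₀(1 + log ε⁻¹)^p`, (2.5) `λ(ε) = λε^{4−d}`), so that F15's/F18a's free letters `T, m′` and the hypothesis `c₁·tPhi·pℓ ≤ T·s^{−m′}` DISAPPEAR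
# (`eq265_higgs_region_size_printed`, `eq265_higgs_tower_size_printed`)

statement-level skeleton of published theorems with citation tags; proofs where landed; nothing here is a claim
about the Yang–Mills mass gap

PDF held: `paper:balaban1982-cmp86-higgs23-ii` (journal page = PDF page + 554), p. 570 [PDF 16] ((2.54) «and the restrictions on the fields A, φ given by the
characteristic functions χ_k:» (2.55) «|(∂A)(b)| ≦ c₁p(L^{k−1}ε), |A(x)| ≦ (c₁/(μ₀L^{k−1}ε))p(L^{k−1}ε), |(D_{Ā^{(k)}}φ)(b)| ≦ c₁p(L^{k−1}ε),
|φ(x)| ≦ (c₁/λ(L^{k−1}ε)^{1/4})p(L^{k−1}ε) for x ∈ Λ^{(k−1)′}₋₁, b ⊂ Λ^{(k−1)′}₋₁»; (2.56)), p. 557 [PDF 3] ((2.2) «p(ε) = b₀(1 + log ε⁻¹)^p», «p > 2»; (2.5) «e(ε) = eε^{(4−d)/2}, λ(ε) = λε^{4−d}»),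
p. 572 [PDF 18] (Lemma 2.4 «under the restrictions (2.55) we have (2.65)»; (2.67); (2.68)), p. 573 [PDF 19] ((2.75)–(2.76)), p. 558 [PDF 4] ((2.7)).

CITATION HEADER (lean-in-tree rule).  T. Bałaban, *(Higgs)₂,₃ quantum fields in a finite volume. II. An upper bound*,
Commun. Math. Phys. **86** (1982) 555–594, doi:10.1007/bf01214890 [Balaban1982Higgs2].  Cell `lit-balaban` (HOME
`run/shared/lean/pub/lit-balaban/`), Phase-2 proof seat **p23** gen 23 (unit `lit-balaban-p23-g23`; free-target protocol G.5-34(d), TAKING #5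
line HOME/STATUS.md 2026-08-23); SKELETON row **B2.Lem2.4** (fold owner r02, second reader r14; head `proved p250408 · …` UNCHANGED —
cells-only member, brick F19; v1.1 = DOC-ONLY: the (2.55)₁,₂ quotation corrected to print's «|(∂A)(b)|, |A(x)|» per the second reader's
note SECONDREAD-B2 v56, r14 g22 2026-08-23 — no declaration touched).  USED BY NAME, never restated: own F18 `B2Eq265PrintedSize.eq265_higgs_region_size` / `eq265_higgs_tower_size`;
own `B2Eq2108ErrorBound.printedThreshold_thrPhi_le` (row B2.Eq2.108's v1.3 §6: the printed (2.55)₄ threshold is `≤ T·ℓ^{−m}` for every `d`);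
the typer's `B2Eq255Concrete.Restr255Printed` (= `Restr255 C c₁ (p(ℓ′)) (1/(μ₀ℓ′)) (1/λ(ℓ′)^{1/4})` by `rfl`), `B2LargeField.lambdaEps` (2.5),
`lambdaEps_pos`, b2b's `B2.pFn` (2.2), `B2.Params.Printed` (`b₀ > 0`, `p > 2`).

THE ARGUMENT.  F18's theorems hold for general (2.55) letters `c₁, pℓ, tA, tPhi ≥ 0` and a free scale `s ∈ (0, 1]` under the reading
`c₁·tPhi·pℓ ≤ T·s^{−m′}`.  Print's letters are `pℓ = p(L^{k−1}ε)`, `tA = 1/(μ₀L^{k−1}ε)`, `tPhi = 1/λ(L^{k−1}ε)^{1/4}` with `L^{k−1}ε = (Lᵏε)/L`;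
at `ℓ′ := s/L ∈ (0, 1]` (`L > 1`) they are `≥ 0`, and `c₁p(s/L)/λ(s/L)^{1/4} ≤ (c₁λ^{−1/4}b₀L^{(4−d)/4+p})·s^{−((4−d)/4+p)}` on `0 < s ≤ 1` is own
`printedThreshold_thrPhi_le` — so F18 applies with `T := c₁λ^{−1/4}b₀L^{(4−d)/4+p} ≥ 0`, `m′ := (4−d)/4 + p` (`d = P.d`, print's `d = 2, 3`:
`m′ = 1/2 + p`, `1/4 + p`), and its `C′` (which absorbed `T`) is the `C′` here.

WHAT THIS FILE PROVES (kernel-checked, zero `sorry`; theorems only — NO definition, NO `Prop`-valued fact; axioms standard).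
 **`eq265_higgs_region_size_printed`** — F18's `eq265_higgs_region_size` word for word except (located edits): leading binders
 `{T : ℝ} (hT : 0 ≤ T) (mexp : ℝ)` ↦ `{c₁ lam : ℝ} (hc₁ : 0 ≤ c₁) (hlam : 0 < lam)` (`c₁`, `λ` join the model parameters in front of the
 constants); the (2.55) letters `{c₁ pℓ tA tPhi : ℝ}, 0 ≤ c₁ → 0 ≤ pℓ → 0 ≤ tPhi → 0 ≤ tA →` ↦ `{μ₀ : ℝ}, 0 < μ₀ →`; the threshold-size reading
 `c₁ * tPhi * pℓ ≤ T * s ^ (-mexp) →` DELETED; `Restr255 C c₁ pℓ tA tPhi` ↦ `Restr255Printed C c₁ Q.b₀ Q.p μ₀ lam (s / L)`; and `pℓ ↦ p(s/L)`,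
 `tA ↦ 1/(μ₀(s/L))`, `tPhi ↦ 1/λ(s/L)^{1/4}` substituted at every remaining occurrence (the `δ_A` hypothesis and the bound).
 **`eq265_higgs_tower_size_printed`** — the same over F18's `eq265_higgs_tower_size` (print's own tower regions, cube size `M`, level `j + 1`).

HONEST SCOPE / DIFFERENCES FROM PRINT (recorded, not hidden; one sentence each).  (a) The (2.55) letter is TIED to the free physical scale,
`ℓ′ = s/L` (print: `L^{k−1}ε` and `Lᵏε`) — reading-independent; which typed quantity `s` is ((U)/(P), Q-p23g23-1) stays the user's.  (b) `c₁ ≥ 0`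
and `λ > 0` are quantified IN FRONT of the constants (`δ, C_V, C_F, K₀min, e₁, t, C₁…D₄, C′, E₁…E₃` may depend on them; in print `c₁` is a
fixed constant of the procedure and `λ` the coupling); `μ₀ > 0` is a free letter NOT identified with `√mu0sq` of the action (as in F13's
`…printed255`); `b₀, p` are the printed `Q.b₀ > 0`, `Q.p > 2` of the SAME `Q` as `r(·)`; the `L` of `T` is the lattice's `L` (`P.L = L`).
(c) Still READ: the radii multiples `θ₁, θ₂ > 0` (print `4r`, `2r` about `y`) and the exponent `κ`; everything of F18's HONEST SCOPE (a)–(d)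
otherwise (bookkeeping only; the sizes of `λ_A = ℓ·c₁p(s/L)`, `X`, `t′·X` under the (2.5) dictionary for `e(·)` NOT evaluated; `0 ≤ tA` is now
automatic).  (d) Nothing minted: `T, m′` are the displayed closed forms, all constants are F18's (hence F13's / Lemma 2.3's / r14's).
NOT summit progress.
-/

open scoped BigOperators

noncomputable section

namespace Literature.MathematicalPhysics.QuantumFieldTheory.Balaban1983to89.B2Eq265PrintedThresholds

open HiggsLattice (ChargeData)
open HiggsAveraging (blockIter toFinest)
open HiggsCovariance (avgQkAdj)
open B2Eq255Concrete (bgScalar256 underRegion mem_underRegion Restr255 Restr255Printed)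
open B2Eq265PrintedSize (eq265_higgs_region_size eq265_higgs_tower_size)
open B2Eq324NestedRegions (prime)
open B2Eq243RegionsTower (towerRegion)
open B2Eq28RegionsConcrete (near)
open B2Lemma23HiggsLattice (cutMin)
open B1Eq211ZeroFieldTorus (Shape)
open B3MultiscaleFields (toSite ofSite)
open B1Ineq225RegularBox (cellBox)
open B1TorusRegionHSizes (IsBigBlockUnion)
open B1TorusCubeCover (half)
open B1TorusCubeLocality26 (rS)

variable {P : HiggsLattice.Params} {k : ℕ}

/-! ## §1 General regions, cube size `K₀ ∣ M` -/

/-- **LEMMA 2.4 (2.65), VALUE CLAUSE, UNDER THE PRINTED RESTRICTIONS (2.55) — F18's grouped bound with the (2.55)₄ threshold size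
DISCHARGED.**  TYPED vs PRINTED: own F18 `B2Eq265PrintedSize.eq265_higgs_region_size` word for word except the located edits listed in the
header (`{T} (hT) (mexp)` ↦ `{c₁ lam} (hc₁ : 0 ≤ c₁) (hlam : 0 < lam)`; letters `{c₁ pℓ tA tPhi}` + signs ↦ `{μ₀}, 0 < μ₀ →`; the reading
`c₁·tPhi·pℓ ≤ T·s^{−m′}` deleted; `Restr255` ↦ `Restr255Printed C c₁ Q.b₀ Q.p μ₀ lam (s / L)`; `pℓ, tA, tPhi` ↦ `p(s/L)`, `1/(μ₀(s/L))`,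
`1/λ(s/L)^{1/4}`).  [cite: Balaban1982Higgs2, Lemma 2.4 (2.65) p.572 «under the restrictions (2.55) we have (2.65)»]
[cite: Balaban1982Higgs2, (2.55) p.570 «|(∂A)(b)| ≦ c₁p(L^{k−1}ε), |A(x)| ≦ (c₁/(μ₀L^{k−1}ε))p(L^{k−1}ε), |(D_{Ā^{(k)}}φ)(b)| ≦ c₁p(L^{k−1}ε), |φ(x)| ≦ (c₁/λ(L^{k−1}ε)^{1/4})p(L^{k−1}ε) for x ∈ Λ^{(k−1)′}₋₁, b ⊂ Λ^{(k−1)′}₋₁»]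
[cite: Balaban1982Higgs2, (2.2) p.557 «p(ε) = b₀(1 + log ε⁻¹)^p», (2.5) p.557 «λ(ε) = λε^{4−d}», (2.7) p.558, (2.68) p.572, (2.75)–(2.76) p.573] -/
theorem eq265_higgs_region_size_printed (d L : ℕ) (hd : 1 ≤ d) (hL : Odd L ∧ 1 < L) {a : ℝ} (ha : 0 < a) {msq : ℝ} (hmsq : 0 < msq)
    {aV : ℝ} (haV : 0 < aV) {mu0sq : ℝ} (hmu0 : 0 < mu0sq)
    (N : ℕ) (C : ChargeData N) (ε₀ : ℝ) (creg β : ℝ) (hcreg : 0 ≤ creg) (hβ : 0 < β)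
    (Q : B2.Params) (hQ : Q.Printed) {c₁ lam : ℝ} (hc₁ : 0 ≤ c₁) (hlam : 0 < lam) {θ₁ θ₂ : ℝ} (hθ₁ : 0 < θ₁) (hθ₂ : 0 < θ₂)
    (κ : ℝ) :
    ∃ δ CV CF : ℝ, 0 < δ ∧ 0 < CV ∧ 0 < CF ∧
    ∃ K₀min : ℕ, ∀ K₀ : ℕ, K₀min ≤ K₀ → ∃ e₁ t : ℝ, 0 < e₁ ∧ 0 < t ∧
      ∃ C₁ C₂ C₃ D₁ D₂ D₃ D₄ : ℝ, 0 ≤ C₁ ∧ 0 ≤ C₂ ∧ 0 ≤ C₃ ∧ 0 ≤ D₁ ∧ 0 ≤ D₂ ∧ 0 ≤ D₃ ∧ 0 ≤ D₄ ∧ ∃ C' : ℝ, 0 ≤ C' ∧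
      ∃ E₁ E₂ E₃ : ℝ, 0 ≤ E₁ ∧ 0 ≤ E₂ ∧ 0 ≤ E₃ ∧
      ∀ (P : HiggsLattice.Params) (_ : Shape P), P.d = d → P.L = L → K₀ ∣ P.M →
      ∀ {k : ℕ}, 1 ≤ k → k ≤ P.K → (∀ μ, 3 * half P k K₀ ≤ P.sitesPerDir 0 μ) → P.mesh k ≤ ε₀ → P.mesh k ≤ 1 →
      ∀ (Λ₂ Λ₆ sq₂ sq₁ : Finset (HiggsLattice.Site P k)) (S : Fin P.d → Finset ℕ) (q : HiggsLattice.Site P k) (Sbox : ℕ),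
        Λ₆ ⊆ Λ₂ → sq₂ ⊆ Λ₂ → sq₁ ⊆ Λ₆ →
        IsBigBlockUnion k K₀ (underRegion k Λ₂) → underRegion k sq₂ = cellBox k K₀ S →
        (∀ μ : Fin P.d, P.L ^ k * Sbox < P.sitesPerDir 0 μ) →
      -- `□₂` IS the box `q + [0,S)ᵈ` of coarse sites, `□ = B^k(□₂)` smaller than half the torus
        (∀ y : HiggsLattice.Site P k, y ∈ sq₂ ↔ ∀ ν : Fin P.d, (y ν - q ν).val < Sbox) →
        (∀ μ : Fin P.d, 2 * (P.L ^ k * Sbox) ≤ P.sitesPerDir 0 μ) →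
      -- `□₁` is the box of coarse sites of radius `R₁` (corner `q₁`); `m ≥ R₁` a coarse margin with `Lᵏm ≥` the depth radius
      ∀ (q₁ : HiggsLattice.Site P k) (R₁ m : ℕ), R₁ ≤ m → 2 * rS P k K₀ + 2 * half P k K₀ * (P.d + 1) + 1 ≤ P.L ^ k * m →
        (∀ y : HiggsLattice.Site P k, y ∈ sq₁ ↔ ∀ ν : Fin P.d, (y ν - q₁ ν).val < 2 * R₁ + 1) →
      -- the region `Λ₋₁` of (2.55); the cutoff `ζ^{(k)}` of (2.44); the cube of radius `R_n ≥ ρ + 1` about every `y ∈ Λ₂` inside `Λ₋₁` ((2.8))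
      ∀ (Λm1 : Finset (HiggsLattice.Site P k))
        (ζ : HiggsLattice.Site P 0 → HiggsLattice.Site P k → ℝ) (ρ ρ₁ : ℝ), 0 ≤ ρ₁ →
        (∀ x y', |ζ x y'| ≤ 1) →
        (∀ x y', ζ x y' ≠ 0 → (HiggsLattice.Site.tdist (blockIter k x) y' : ℝ) ≤ ρ) →
        (∀ x y', (HiggsLattice.Site.tdist (blockIter k x) y' : ℝ) ≤ ρ₁ → ζ x y' = 1) →
        (∀ (x : HiggsLattice.Site P 0) (ν : Fin P.d) (y' : HiggsLattice.Site P k), |ζ (x.shift ν) y' - ζ x y'| ≤ ((P.L : ℝ) ^ k)⁻¹) →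
      ∀ (Rn : ℕ), ρ + 1 ≤ (Rn : ℝ) → (∀ μ : Fin P.d, 2 * (2 * Rn + 1) ≤ P.sitesPerDir k μ) →
        (∀ y ∈ Λ₂, ∀ y' : HiggsLattice.Site P k, HiggsLattice.Site.tdist y y' ≤ Rn → y' ∈ Λm1) →
      -- a charge datum on `ℝ^d`, the step's vector field `A′`, and print's `μ₀` of the (2.55)₂ threshold
      ∀ (C₀ : ChargeData P.d) (A' : HiggsLattice.VecField P k) {μ₀ : ℝ}, 0 < μ₀ →
      -- THE PHYSICAL SCALE `s ⇐ Lᵏε` AS A FREE LETTER (F18a), the (2.55) letter `L^{k−1}ε ⇐ s/L`: radii readings `m ≥ θ₁r(s)`, `R₁ + 1 ≥ θ₂r(s)`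
      ∀ {s : ℝ}, 0 < s → s ≤ 1 →
        θ₁ * B2.rFn Q.R Q.r s ≤ (m : ℝ) → θ₂ * B2.rFn Q.R Q.r s ≤ (R₁ : ℝ) + 1 →
      -- `δA` is at least the (2.60) bound read off the PRINTED (2.55)₁,₂ thresholds at `ℓ′ = s/L`, and small in the two printed scalings
      ∀ {δA : ℝ}, ((P.L : ℝ) ^ k)⁻¹ * (CV * P.d * (P.mesh k * (c₁ * B2.pFn Q.b₀ Q.p (s / (L : ℝ)))) + CF * Real.exp (-(δ * ρ₁)) * (c₁ * (1 / (μ₀ * (s / (L : ℝ)))) * B2.pFn Q.b₀ Q.p (s / (L : ℝ)))) ≤ δA →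
          (P.L : ℝ) ^ k * δA * |C.e| ≤ t →
        ∀ {ec : ℝ}, 0 < ec → ec ≤ e₁ → (P.L : ℝ) ^ k * P.mesh k * |C.e| * δA ≤ creg * ec ^ β →
      -- `x ∈ Bᵏ(ȳ)` with `ȳ` the centre of `□₁` and at least `m` inside `□₂` in every direction
      ∀ (x : HiggsLattice.Site P 0),
        (∀ ν : Fin P.d, m ≤ ((blockIter k x) ν - q ν).val ∧ ((blockIter k x) ν - q ν).val + m < Sbox) →
        (∀ ν : Fin P.d, ((blockIter k x) ν - q₁ ν).val = R₁) →
      -- THE PRINTED RESTRICTIONS (2.55) on `Λ₋₁` for `A′, φ` and the background `A^{(k)}`: thresholds `c₁p(ℓ′)`, `c₁p(ℓ′)/(μ₀ℓ′)`, `c₁p(ℓ′)`, `c₁p(ℓ′)/λ(ℓ′)^{1/4}` at `ℓ′ = s/L`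
      ∀ (φ : HiggsLattice.ScalarField P k N),
        Restr255Printed C c₁ Q.b₀ Q.p μ₀ lam (s / (L : ℝ)) k Λm1 A' φ (ofSite (cutMin C₀ mu0sq aV k ζ (toSite A'))) →
        ‖bgScalar256 C msq a k Λ₂ Λ₆ (ofSite (cutMin C₀ mu0sq aV k ζ (toSite A'))) φ x
            - avgQkAdj C (ofSite (cutMin C₀ mu0sq aV k ζ (toSite A'))) k φ x‖
          ≤ C' * B1.aSeq a P.L k * s ^ κ
            + 4 * K₀ * P.d * C₃ * B1.aSeq a P.L k * (P.mesh k * (c₁ * B2.pFn Q.b₀ Q.p (s / (L : ℝ))))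
            + (c₁ * (1 / (B2LargeField.lambdaEps lam (s / (L : ℝ)) P.d) ^ (1 / 4 : ℝ)) * B2.pFn Q.b₀ Q.p (s / (L : ℝ))) * (|C.e| * (δA * (P.d * ((P.L : ℝ) ^ k * Sbox)))) * P.mesh k *
                (B1.aSeq a P.L k * (E₁ + 4 * K₀ * P.d * C₃) + P.d + E₂ * B1.aSeq a P.L k ^ 2
                  + (|C.e| * (δA * (P.d * ((P.L : ℝ) ^ k * Sbox)))) * P.mesh k * B1.aSeq a P.L k * (E₂ + E₃ * B1.aSeq a P.L k))
            + msq * P.mesh k ^ 2 / (B1.aSeq a P.L k + msq * P.mesh k ^ 2) * (c₁ * (1 / (B2LargeField.lambdaEps lam (s / (L : ℝ)) P.d) ^ (1 / 4 : ℝ)) * B2.pFn Q.b₀ Q.p (s / (L : ℝ))) := by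
  have hp2 : 2 < Q.p := hQ.1
  have hb0 : 0 < Q.b₀ := hQ.2.2.2.2.2.2.1
  have hL1 : (1 : ℝ) ≤ (L : ℝ) := by exact_mod_cast hL.2.le
  have hT : 0 ≤ c₁ * lam ^ (-(1 / 4 : ℝ)) * Q.b₀ * (L : ℝ) ^ (((4 : ℝ) - d) / 4 + Q.p) := by
    have := hb0.le; positivity
  obtain ⟨δ, CV, CF, hδ, hCV, hCF, K₀min, h⟩ :=
    eq265_higgs_region_size d L hd hL ha hmsq haV hmu0 N C ε₀ creg β hcreg hβ Q hQ hT (((4 : ℝ) - d) / 4 + Q.p) hθ₁ hθ₂ κ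
  refine ⟨δ, CV, CF, hδ, hCV, hCF, K₀min, fun K₀ hK₀ => ?_⟩
  obtain ⟨e₁, t, he₁, ht, C₁, C₂, C₃, D₁, D₂, D₃, D₄, hC₁, hC₂, hC₃, hD₁, hD₂, hD₃, hD₄, C', hC', E₁, E₂, E₃, hE₁, hE₂, hE₃, h⟩ :=
    h K₀ hK₀
  refine ⟨e₁, t, he₁, ht, C₁, C₂, C₃, D₁, D₂, D₃, D₄, hC₁, hC₂, hC₃, hD₁, hD₂, hD₃, hD₄, C', hC', E₁, E₂, E₃, hE₁, hE₂, hE₃, ?_⟩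
  intro P S hPd hPL hK₀M k hk1 hkK h3 hε h1 Λ₂ Λ₆ sq₂ sq₁ Sfin q Sbox h62 hs2 h16 hΩΛ hbox hSbox hsq₂ h2S q₁ R₁ m hR₁m hRm hsq₁
    Λm1 ζ ρ ρ₁ hρ₁ zeta_abs zeta_supp zeta_one zeta_lip Rn hRn hRn2 hcube C₀ A' μ₀ hμ₀ s hs hs1 hθm hθR δA h60δ ht' ec hec hle hsmall x
    hmargin hcentre φ h255
  subst hPd
  -- the (2.55) letter `ℓ′ = s/L ∈ (0, 1]` and the signs of the printed thresholds
  have hL0 : (0 : ℝ) < (L : ℝ) := by linarith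
  have hℓ : 0 < s / (L : ℝ) := div_pos hs hL0
  have hℓ1 : s / (L : ℝ) ≤ 1 := (div_le_self hs.le hL1).trans hs1
  have hlog : 0 ≤ 1 + Real.log (s / (L : ℝ))⁻¹ := by
    have := Real.log_nonneg ((one_le_inv₀ hℓ).mpr hℓ1)
    linarith
  have hpℓ : 0 ≤ B2.pFn Q.b₀ Q.p (s / (L : ℝ)) := mul_nonneg hb0.le (Real.rpow_nonneg hlog _)
  have htPhi : 0 ≤ 1 / (B2LargeField.lambdaEps lam (s / (L : ℝ)) P.d) ^ (1 / 4 : ℝ) :=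
    div_nonneg zero_le_one (Real.rpow_nonneg (B2LargeField.lambdaEps_pos hlam hℓ P.d).le _)
  have htA : 0 ≤ (1 / (μ₀ * (s / (L : ℝ)))) := by positivity
  -- THE THRESHOLD SIZE, DISCHARGED: `c₁p(ℓ′)/λ(ℓ′)^{1/4} ≤ (c₁λ^{−1/4}b₀L^{(4−d)/4+p})·s^{−((4−d)/4+p)}` (own `printedThreshold_thrPhi_le`)
  have htT : (c₁ * (1 / (B2LargeField.lambdaEps lam (s / (L : ℝ)) P.d) ^ (1 / 4 : ℝ)) * B2.pFn Q.b₀ Q.p (s / (L : ℝ)))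
      ≤ c₁ * lam ^ (-(1 / 4 : ℝ)) * Q.b₀ * (L : ℝ) ^ (((4 : ℝ) - P.d) / 4 + Q.p) * s ^ (-(((4 : ℝ) - P.d) / 4 + Q.p)) := by
    have h' := B2Eq2108ErrorBound.printedThreshold_thrPhi_le hlam hc₁ hb0.le (by linarith : (0 : ℝ) ≤ Q.p) hL1 hs hs1 P.d
    have hre : (c₁ * (1 / (B2LargeField.lambdaEps lam (s / (L : ℝ)) P.d) ^ (1 / 4 : ℝ)) * B2.pFn Q.b₀ Q.p (s / (L : ℝ)))
        = c₁ * B2LargeField.thrPhi lam (s / (L : ℝ)) P.d (B2.pFn Q.b₀ Q.p (s / (L : ℝ))) := by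
      unfold B2LargeField.thrPhi; ring
    rw [hre]; exact h'
  have h255' : Restr255 C c₁ (B2.pFn Q.b₀ Q.p (s / (L : ℝ))) (1 / (μ₀ * (s / (L : ℝ)))) (1 / (B2LargeField.lambdaEps lam (s / (L : ℝ)) P.d) ^ (1 / 4 : ℝ)) k
      Λm1 A' φ (ofSite (cutMin C₀ mu0sq aV k ζ (toSite A'))) := h255
  exact h P S rfl hPL hK₀M hk1 hkK h3 hε h1 Λ₂ Λ₆ sq₂ sq₁ Sfin q Sbox h62 hs2 h16 hΩΛ hbox hSbox hsq₂ h2S q₁ R₁ m hR₁m hRm hsq₁ Λm1 ζ ρ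
    ρ₁ hρ₁ zeta_abs zeta_supp zeta_one zeta_lip Rn hRn hRn2 hcube C₀ A' hc₁ hpℓ htPhi htA hs hs1 hθm hθR htT h60δ ht' hec hle hsmall x
    hmargin hcentre φ h255'

/-! ## §2 Print's own tower regions, cube size `M` -/

/-- **LEMMA 2.4 (2.65), VALUE CLAUSE, UNDER THE PRINTED RESTRICTIONS (2.55), FOR PRINT'S OWN REGIONS `Λ₂^{(k−1)′} ⊇ Λ₆^{(k−1)′}`,
`Λ₋₁^{(k−1)′} ⊇ (near Λ₀^{(k−1)} r)′`.**  TYPED vs PRINTED: own F18 `B2Eq265PrintedSize.eq265_higgs_tower_size` with the located edits of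
`eq265_higgs_region_size_printed` (level `j + 1`, cube size `M`); `rad`, `bad` data; nothing minted.
[cite: Balaban1982Higgs2, Lemma 2.4 (2.65) p.572, (2.55)–(2.56) p.570, (2.7)–(2.8) p.558, (2.43) p.566, (2.2)/(2.5) p.557]
[cite: Balaban1982Higgs1, Prop. 2.1 p.610 «let Ω^{(k)} ⊂ T^{(k)}_1 be a sum of big blocks with M sufficiently large»] -/
theorem eq265_higgs_tower_size_printed (d L : ℕ) (hd : 1 ≤ d) (hL : Odd L ∧ 1 < L) {a : ℝ} (ha : 0 < a) {msq : ℝ} (hmsq : 0 < msq)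
    {aV : ℝ} (haV : 0 < aV) {mu0sq : ℝ} (hmu0 : 0 < mu0sq)
    (N : ℕ) (C : ChargeData N) (ε₀ : ℝ) (creg β : ℝ) (hcreg : 0 ≤ creg) (hβ : 0 < β)
    (Q : B2.Params) (hQ : Q.Printed) {c₁ lam : ℝ} (hc₁ : 0 ≤ c₁) (hlam : 0 < lam) {θ₁ θ₂ : ℝ} (hθ₁ : 0 < θ₁) (hθ₂ : 0 < θ₂)
    (κ : ℝ) :
    ∃ δ CV CF : ℝ, 0 < δ ∧ 0 < CV ∧ 0 < CF ∧
    ∃ Mmin : ℕ, ∀ M : ℕ, Mmin ≤ M → ∃ e₁ t : ℝ, 0 < e₁ ∧ 0 < t ∧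
      ∃ C₁ C₂ C₃ D₁ D₂ D₃ D₄ : ℝ, 0 ≤ C₁ ∧ 0 ≤ C₂ ∧ 0 ≤ C₃ ∧ 0 ≤ D₁ ∧ 0 ≤ D₂ ∧ 0 ≤ D₃ ∧ 0 ≤ D₄ ∧ ∃ C' : ℝ, 0 ≤ C' ∧
      ∃ E₁ E₂ E₃ : ℝ, 0 ≤ E₁ ∧ 0 ≤ E₂ ∧ 0 ≤ E₃ ∧
      ∀ (P : HiggsLattice.Params) (_ : Shape P), P.d = d → P.L = L → P.M = M →
      ∀ {j : ℕ}, j + 1 ≤ P.K → (∀ μ, 3 * half P (j + 1) M ≤ P.sitesPerDir 0 μ) → P.mesh (j + 1) ≤ ε₀ → P.mesh (j + 1) ≤ 1 →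
      -- PRINT'S OWN REGIONS: the (2.7)–(2.8)/(2.43) tower of step `j`, primed to `T^{(k)}`, `k = j + 1`; `Λ₂′ ⊇ □₂`, `Λ₆′ ⊇ □₁`
      ∀ (bad : (l : ℕ) → Set (HiggsLattice.Site P l)) (rad : ℕ → ℝ), 0 < rad j →
      ∀ (sq₂ sq₁ : Finset (HiggsLattice.Site P (j + 1))) (S : Fin P.d → Finset ℕ) (q : HiggsLattice.Site P (j + 1)) (Sbox : ℕ),
        sq₂ ⊆ prime (towerRegion bad rad j 2) → sq₁ ⊆ prime (towerRegion bad rad j 6) →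
        underRegion (j + 1) sq₂ = cellBox (j + 1) M S →
        (∀ μ : Fin P.d, P.L ^ (j + 1) * Sbox < P.sitesPerDir 0 μ) →
      -- `□₂` IS the box `q + [0,S)ᵈ` of coarse sites, `□ = B^k(□₂)` smaller than half the torus
        (∀ y : HiggsLattice.Site P (j + 1), y ∈ sq₂ ↔ ∀ ν : Fin P.d, (y ν - q ν).val < Sbox) →
        (∀ μ : Fin P.d, 2 * (P.L ^ (j + 1) * Sbox) ≤ P.sitesPerDir 0 μ) →
      -- `□₁` is the box of coarse sites of radius `R₁` (corner `q₁`); `m ≥ R₁` a coarse margin with `Lᵏm ≥` the depth radius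
      ∀ (q₁ : HiggsLattice.Site P (j + 1)) (R₁ m : ℕ), R₁ ≤ m → 2 * rS P (j + 1) M + 2 * half P (j + 1) M * (P.d + 1) + 1 ≤ P.L ^ (j + 1) * m →
        (∀ y : HiggsLattice.Site P (j + 1), y ∈ sq₁ ↔ ∀ ν : Fin P.d, (y ν - q₁ ν).val < 2 * R₁ + 1) →
      -- the cutoff `ζ^{(k)}` of (2.44)
      ∀ (ζ : HiggsLattice.Site P 0 → HiggsLattice.Site P (j + 1) → ℝ) (ρ ρ₁ : ℝ), 0 ≤ ρ₁ →
        (∀ x y', |ζ x y'| ≤ 1) →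
        (∀ x y', ζ x y' ≠ 0 → (HiggsLattice.Site.tdist (blockIter (j + 1) x) y' : ℝ) ≤ ρ) →
        (∀ x y', (HiggsLattice.Site.tdist (blockIter (j + 1) x) y' : ℝ) ≤ ρ₁ → ζ x y' = 1) →
        (∀ (x : HiggsLattice.Site P 0) (ν : Fin P.d) (y' : HiggsLattice.Site P (j + 1)), |ζ (x.shift ν) y' - ζ x y'| ≤ ((P.L : ℝ) ^ (j + 1))⁻¹) →
      -- the cube of radius `R_n ≥ ρ + 1` about `y ∈ Λ₂′` lies in `Λ₋₁′ := (near Λ₀^{(j)} r(Lʲε))′` once `L(R_n + 1) − 1 ≤ 3n`, `n < r(Lʲε)` ((2.8) collars)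
      ∀ (Rn : ℕ), ρ + 1 ≤ (Rn : ℝ) → (∀ μ : Fin P.d, 2 * (2 * Rn + 1) ≤ P.sitesPerDir (j + 1) μ) →
      ∀ (n : ℕ), (n : ℝ) < rad j → (P.L : ℝ) * ((Rn : ℝ) + 1) - 1 ≤ 3 * (n : ℝ) →
      -- a charge datum on `ℝ^d`, the step's vector field `A′`, and print's `μ₀` of the (2.55)₂ threshold
      ∀ (C₀ : ChargeData P.d) (A' : HiggsLattice.VecField P (j + 1)) {μ₀ : ℝ}, 0 < μ₀ →
      -- THE PHYSICAL SCALE `s ⇐ Lᵏε` AS A FREE LETTER (F18a), the (2.55) letter `L^{k−1}ε ⇐ s/L`: radii readings `m ≥ θ₁r(s)`, `R₁ + 1 ≥ θ₂r(s)`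
      ∀ {s : ℝ}, 0 < s → s ≤ 1 →
        θ₁ * B2.rFn Q.R Q.r s ≤ (m : ℝ) → θ₂ * B2.rFn Q.R Q.r s ≤ (R₁ : ℝ) + 1 →
      -- `δA` is at least the (2.60) bound read off the PRINTED (2.55)₁,₂ thresholds at `ℓ′ = s/L`, and small in the two printed scalings
      ∀ {δA : ℝ}, ((P.L : ℝ) ^ (j + 1))⁻¹ * (CV * P.d * (P.mesh (j + 1) * (c₁ * B2.pFn Q.b₀ Q.p (s / (L : ℝ)))) + CF * Real.exp (-(δ * ρ₁)) * (c₁ * (1 / (μ₀ * (s / (L : ℝ)))) * B2.pFn Q.b₀ Q.p (s / (L : ℝ)))) ≤ δA →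
          (P.L : ℝ) ^ (j + 1) * δA * |C.e| ≤ t →
        ∀ {ec : ℝ}, 0 < ec → ec ≤ e₁ → (P.L : ℝ) ^ (j + 1) * P.mesh (j + 1) * |C.e| * δA ≤ creg * ec ^ β →
      -- `x ∈ Bᵏ(ȳ)` with `ȳ` the centre of `□₁` and at least `m` inside `□₂` in every direction
      ∀ (x : HiggsLattice.Site P 0),
        (∀ ν : Fin P.d, m ≤ ((blockIter (j + 1) x) ν - q ν).val ∧ ((blockIter (j + 1) x) ν - q ν).val + m < Sbox) →
        (∀ ν : Fin P.d, ((blockIter (j + 1) x) ν - q₁ ν).val = R₁) →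
      -- THE PRINTED RESTRICTIONS (2.55) on `Λ₋₁` for `A′, φ` and the background `A^{(k)}`: thresholds `c₁p(ℓ′)`, `c₁p(ℓ′)/(μ₀ℓ′)`, `c₁p(ℓ′)`, `c₁p(ℓ′)/λ(ℓ′)^{1/4}` at `ℓ′ = s/L`
      ∀ (φ : HiggsLattice.ScalarField P (j + 1) N),
        Restr255Printed C c₁ Q.b₀ Q.p μ₀ lam (s / (L : ℝ)) (j + 1) (prime (near (towerRegion bad rad j 0) (rad j))) A' φ
          (ofSite (cutMin C₀ mu0sq aV (j + 1) ζ (toSite A'))) →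
        ‖bgScalar256 C msq a (j + 1) (prime (towerRegion bad rad j 2)) (prime (towerRegion bad rad j 6))
              (ofSite (cutMin C₀ mu0sq aV (j + 1) ζ (toSite A'))) φ x
            - avgQkAdj C (ofSite (cutMin C₀ mu0sq aV (j + 1) ζ (toSite A'))) (j + 1) φ x‖
          ≤ C' * B1.aSeq a P.L (j + 1) * s ^ κ
            + 4 * M * P.d * C₃ * B1.aSeq a P.L (j + 1) * (P.mesh (j + 1) * (c₁ * B2.pFn Q.b₀ Q.p (s / (L : ℝ))))
            + (c₁ * (1 / (B2LargeField.lambdaEps lam (s / (L : ℝ)) P.d) ^ (1 / 4 : ℝ)) * B2.pFn Q.b₀ Q.p (s / (L : ℝ))) * (|C.e| * (δA * (P.d * ((P.L : ℝ) ^ (j + 1) * Sbox)))) * P.mesh (j + 1) *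
                (B1.aSeq a P.L (j + 1) * (E₁ + 4 * M * P.d * C₃) + P.d + E₂ * B1.aSeq a P.L (j + 1) ^ 2
                  + (|C.e| * (δA * (P.d * ((P.L : ℝ) ^ (j + 1) * Sbox)))) * P.mesh (j + 1) * B1.aSeq a P.L (j + 1) * (E₂ + E₃ * B1.aSeq a P.L (j + 1)))
            + msq * P.mesh (j + 1) ^ 2 / (B1.aSeq a P.L (j + 1) + msq * P.mesh (j + 1) ^ 2) * (c₁ * (1 / (B2LargeField.lambdaEps lam (s / (L : ℝ)) P.d) ^ (1 / 4 : ℝ)) * B2.pFn Q.b₀ Q.p (s / (L : ℝ))) := by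
  have hp2 : 2 < Q.p := hQ.1
  have hb0 : 0 < Q.b₀ := hQ.2.2.2.2.2.2.1
  have hL1 : (1 : ℝ) ≤ (L : ℝ) := by exact_mod_cast hL.2.le
  have hT : 0 ≤ c₁ * lam ^ (-(1 / 4 : ℝ)) * Q.b₀ * (L : ℝ) ^ (((4 : ℝ) - d) / 4 + Q.p) := by
    have := hb0.le; positivity
  obtain ⟨δ, CV, CF, hδ, hCV, hCF, K₀min, h⟩ :=
    eq265_higgs_tower_size d L hd hL ha hmsq haV hmu0 N C ε₀ creg β hcreg hβ Q hQ hT (((4 : ℝ) - d) / 4 + Q.p) hθ₁ hθ₂ κ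
  refine ⟨δ, CV, CF, hδ, hCV, hCF, K₀min, fun M hM => ?_⟩
  obtain ⟨e₁, t, he₁, ht, C₁, C₂, C₃, D₁, D₂, D₃, D₄, hC₁, hC₂, hC₃, hD₁, hD₂, hD₃, hD₄, C', hC', E₁, E₂, E₃, hE₁, hE₂, hE₃, h⟩ :=
    h M hM
  refine ⟨e₁, t, he₁, ht, C₁, C₂, C₃, D₁, D₂, D₃, D₄, hC₁, hC₂, hC₃, hD₁, hD₂, hD₃, hD₄, C', hC', E₁, E₂, E₃, hE₁, hE₂, hE₃, ?_⟩
  intro P S hPd hPL hPM j hjK h3 hε h1 bad rad hrad sq₂ sq₁ Sfin q Sbox hs2 h16 hbox hSbox hsq₂ h2S q₁ R₁ m hR₁m hRm hsq₁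
    ζ ρ ρ₁ hρ₁ zeta_abs zeta_supp zeta_one zeta_lip Rn hRn hRn2 n hn hroom C₀ A' μ₀ hμ₀ s hs hs1 hθm hθR δA h60δ ht' ec hec hle hsmall x
    hmargin hcentre φ h255
  subst hPd
  -- the (2.55) letter `ℓ′ = s/L ∈ (0, 1]` and the signs of the printed thresholds
  have hL0 : (0 : ℝ) < (L : ℝ) := by linarith
  have hℓ : 0 < s / (L : ℝ) := div_pos hs hL0
  have hℓ1 : s / (L : ℝ) ≤ 1 := (div_le_self hs.le hL1).trans hs1
  have hlog : 0 ≤ 1 + Real.log (s / (L : ℝ))⁻¹ := by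
    have := Real.log_nonneg ((one_le_inv₀ hℓ).mpr hℓ1)
    linarith
  have hpℓ : 0 ≤ B2.pFn Q.b₀ Q.p (s / (L : ℝ)) := mul_nonneg hb0.le (Real.rpow_nonneg hlog _)
  have htPhi : 0 ≤ 1 / (B2LargeField.lambdaEps lam (s / (L : ℝ)) P.d) ^ (1 / 4 : ℝ) :=
    div_nonneg zero_le_one (Real.rpow_nonneg (B2LargeField.lambdaEps_pos hlam hℓ P.d).le _)
  have htA : 0 ≤ (1 / (μ₀ * (s / (L : ℝ)))) := by positivity
  -- THE THRESHOLD SIZE, DISCHARGED: `c₁p(ℓ′)/λ(ℓ′)^{1/4} ≤ (c₁λ^{−1/4}b₀L^{(4−d)/4+p})·s^{−((4−d)/4+p)}` (own `printedThreshold_thrPhi_le`)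
  have htT : (c₁ * (1 / (B2LargeField.lambdaEps lam (s / (L : ℝ)) P.d) ^ (1 / 4 : ℝ)) * B2.pFn Q.b₀ Q.p (s / (L : ℝ)))
      ≤ c₁ * lam ^ (-(1 / 4 : ℝ)) * Q.b₀ * (L : ℝ) ^ (((4 : ℝ) - P.d) / 4 + Q.p) * s ^ (-(((4 : ℝ) - P.d) / 4 + Q.p)) := by
    have h' := B2Eq2108ErrorBound.printedThreshold_thrPhi_le hlam hc₁ hb0.le (by linarith : (0 : ℝ) ≤ Q.p) hL1 hs hs1 P.d
    have hre : (c₁ * (1 / (B2LargeField.lambdaEps lam (s / (L : ℝ)) P.d) ^ (1 / 4 : ℝ)) * B2.pFn Q.b₀ Q.p (s / (L : ℝ)))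
        = c₁ * B2LargeField.thrPhi lam (s / (L : ℝ)) P.d (B2.pFn Q.b₀ Q.p (s / (L : ℝ))) := by
      unfold B2LargeField.thrPhi; ring
    rw [hre]; exact h'
  have h255' : Restr255 C c₁ (B2.pFn Q.b₀ Q.p (s / (L : ℝ))) (1 / (μ₀ * (s / (L : ℝ)))) (1 / (B2LargeField.lambdaEps lam (s / (L : ℝ)) P.d) ^ (1 / 4 : ℝ)) (j + 1)
      (prime (near (towerRegion bad rad j 0) (rad j))) A' φ (ofSite (cutMin C₀ mu0sq aV (j + 1) ζ (toSite A'))) := h255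
  exact h P S rfl hPL hPM hjK h3 hε h1 bad rad hrad sq₂ sq₁ Sfin q Sbox hs2 h16 hbox hSbox hsq₂ h2S q₁ R₁ m hR₁m hRm hsq₁ ζ ρ ρ₁ hρ₁
    zeta_abs zeta_supp zeta_one zeta_lip Rn hRn hRn2 n hn hroom C₀ A' hc₁ hpℓ htPhi htA hs hs1 hθm hθR htT h60δ ht' hec hle hsmall x hmargin
    hcentre φ h255'

end Literature.MathematicalPhysics.QuantumFieldTheory.Balaban1983to89.B2Eq265PrintedThresholds

end
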